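import Mathlib

/-!
# PercRepro — binomial arithmetic for Theorem C∞ (C-025 at large rank and EVERY corank) (night-1, gen 3)

`proofs/NIGHT-1-C025-induction.md` §14. Four elementary inputs, Mathlib only:

* **`sum_choose_le_two_pow_pred`** — `Σ_{j ≤ d} C(n, j) ≤ 2^{n−1}` when `2d + 1 ≤ n` (the small and the large tails
  of Pascal's row are disjoint and equal by symmetry);
* **`descFactorial_le_two_pow_mul`**, **`choose_le_two_pow_mul_choose`** — `C(n, q) ≤ 2^q · C(p + q, q)` when `n ≤ 2p`
  (termwise `n − i ≤ 2(p + q − i)` in the falling factorials);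
* **`sum_choose_le_mul_pow`** — `Σ_{j ≤ k} C(n, j) ≤ (k + 1) · n^k` in `ℕ` (`n ≥ 1`);
* **`choose_le_choose_mul_of_threshold`** — the large-corank input: for `q + 1 ≤ p`, `2p ≤ n` and the threshold
  `2^{p+q} · K · (2 p^{q+1}) ≤ 4^{p−1−q}`, `2^{p+q} · K · C(n, q) ≤ C(n, p − 1)` (the ratio `C(n, p−1)/C(n, q)
  = C(n − q, p − 1 − q)/C(p − 1, q)` is increasing in `n`, and `C(2a, a) ≥ 4^a/(2a + 1)`);
* **`exists_forall_mul_pow_le_two_pow`** — `∀ c k, ∃ N, ∀ n ≥ N, c · n^k ≤ 2^n` (from `n^k / 2^n → 0`).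
Axioms: standard.
-/

namespace PercRepro

open Finset

/-- **The small tail of Pascal's row is at most half of it**: `Σ_{j ≤ d} C(n, j) ≤ 2^{n−1}` when `2d + 1 ≤ n`. -/
theorem sum_choose_le_two_pow_pred (n d : ℕ) (h : 2 * d + 1 ≤ n) :
    ∑ j ∈ Finset.range (d + 1), n.choose j ≤ 2 ^ (n - 1) := by
  classical
  have hinj : Set.InjOn (fun j => n - j) ↑(Finset.range (d + 1)) := by
    intro a ha b hb hab
    simp only [Finset.coe_range, Set.mem_Iio] at ha hb
    simp only at hab
    omega
  have hdisj : Disjoint (Finset.range (d + 1)) ((Finset.range (d + 1)).image (fun j => n - j)) := by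
    rw [Finset.disjoint_left]
    intro j hj hj'
    rw [Finset.mem_range] at hj
    rw [Finset.mem_image] at hj'
    obtain ⟨i, hi, rfl⟩ := hj'
    rw [Finset.mem_range] at hi
    omega
  have hsub : Finset.range (d + 1) ∪ (Finset.range (d + 1)).image (fun j => n - j) ⊆
      Finset.range (n + 1) := by
    intro j hj
    rw [Finset.mem_union, Finset.mem_range, Finset.mem_image] at hj
    rw [Finset.mem_range]
    rcases hj with hj | ⟨i, hi, rfl⟩
    · omega
    · omega
  have h1 : ∑ j ∈ Finset.range (d + 1), n.choose j + ∑ j ∈ Finset.range (d + 1), n.choose j ≤ 2 ^ n := by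
    calc ∑ j ∈ Finset.range (d + 1), n.choose j + ∑ j ∈ Finset.range (d + 1), n.choose j
        = ∑ j ∈ Finset.range (d + 1), n.choose j +
            ∑ j ∈ (Finset.range (d + 1)).image (fun j => n - j), n.choose j := by
          rw [Finset.sum_image hinj]
          congr 1
          apply Finset.sum_congr rfl
          intro j hj
          rw [Finset.mem_range] at hj
          rw [Nat.choose_symm (by omega)]
      _ = ∑ j ∈ Finset.range (d + 1) ∪ (Finset.range (d + 1)).image (fun j => n - j), n.choose j :=
          (Finset.sum_union hdisj).symm
      _ ≤ ∑ j ∈ Finset.range (n + 1), n.choose j :=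
          Finset.sum_le_sum_of_subset_of_nonneg hsub (fun _ _ _ => Nat.zero_le _)
      _ = 2 ^ n := Nat.sum_range_choose n
  have h2 : 2 ^ n = 2 * 2 ^ (n - 1) := by
    rw [← pow_succ']; congr 1; omega
  omega

/-- `n^{\underline k} ≤ 2^k · m^{\underline k}` when `n + k ≤ 2m` (termwise `n − i ≤ 2(m − i)` for `i < k`). -/
theorem descFactorial_le_two_pow_mul (k : ℕ) : ∀ n m : ℕ, n + k ≤ 2 * m →
    n.descFactorial k ≤ 2 ^ k * m.descFactorial k := by
  induction k with
  | zero => intro n m _; simp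
  | succ k ih =>
    intro n m h
    rw [Nat.descFactorial_succ, Nat.descFactorial_succ, pow_succ]
    have h1 : n.descFactorial k ≤ 2 ^ k * m.descFactorial k := ih n m (by omega)
    have h2 : n - k ≤ 2 * (m - k) := by omega
    calc (n - k) * n.descFactorial k ≤ (2 * (m - k)) * (2 ^ k * m.descFactorial k) := Nat.mul_le_mul h2 h1
      _ = 2 ^ k * 2 * ((m - k) * m.descFactorial k) := by ring

/-- **`C(n, q) ≤ 2^q · C(p + q, q)` when `n ≤ 2p`.** -/
theorem choose_le_two_pow_mul_choose (n p q : ℕ) (h : n ≤ 2 * p) :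
    n.choose q ≤ 2 ^ q * (p + q).choose q := by
  have hd := descFactorial_le_two_pow_mul q n (p + q) (by omega)
  rw [Nat.descFactorial_eq_factorial_mul_choose, Nat.descFactorial_eq_factorial_mul_choose] at hd
  have hq : 0 < q.factorial := Nat.factorial_pos q
  have : q.factorial * n.choose q ≤ q.factorial * (2 ^ q * (p + q).choose q) := by
    calc q.factorial * n.choose q ≤ 2 ^ q * (q.factorial * (p + q).choose q) := hd
      _ = q.factorial * (2 ^ q * (p + q).choose q) := by ring
  exact Nat.le_of_mul_le_mul_left this hq

/-- `Σ_{j ≤ k} C(n, j) ≤ (k + 1) · n^k` for `n ≥ 1` (in `ℕ`). -/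
theorem sum_choose_le_mul_pow (n k : ℕ) (hn : 1 ≤ n) :
    ∑ j ∈ Finset.range (k + 1), n.choose j ≤ (k + 1) * n ^ k := by
  have : ∀ j ∈ Finset.range (k + 1), n.choose j ≤ n ^ k := by
    intro j hj
    rw [Finset.mem_range] at hj
    calc n.choose j ≤ n ^ j := Nat.choose_le_pow n j
      _ ≤ n ^ k := Nat.pow_le_pow_right hn (by omega)
  calc ∑ j ∈ Finset.range (k + 1), n.choose j ≤ ∑ _j ∈ Finset.range (k + 1), n ^ k := Finset.sum_le_sum this
    _ = (k + 1) * n ^ k := by rw [Finset.sum_const, Finset.card_range, smul_eq_mul]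

/-- **The large-corank input**: for `q + 1 ≤ p`, `2p ≤ n` and the threshold `2^{p+q} · K · (2 p^{q+1}) ≤ 4^{p−1−q}`,
`2^{p+q} · K · C(n, q) ≤ C(n, p − 1)`. -/
theorem choose_le_choose_mul_of_threshold (n p q K : ℕ) (hqp : q + 1 ≤ p) (hn : 2 * p ≤ n)
    (hT : 2 ^ (p + q) * K * (2 * p ^ (q + 1)) ≤ 4 ^ (p - 1 - q)) :
    2 ^ (p + q) * K * n.choose q ≤ n.choose (p - 1) := by
  set a := p - 1 - q with ha
  -- `C(n − q, a) · (2a + 1) ≥ 4^a`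
  have hcb : 4 ^ a ≤ (2 * a + 1) * (n - q).choose a := by
    calc 4 ^ a ≤ (2 * a + 1) * (2 * a).choose a := Nat.four_pow_le_two_mul_add_one_mul_central_binom a
      _ ≤ (2 * a + 1) * (n - q).choose a := by
          apply Nat.mul_le_mul_left
          exact Nat.choose_le_choose a (by omega)
  -- `C(p − 1, q) · (2a + 1) ≤ 2 p^{q+1}`
  have hsmall : (p - 1).choose q * (2 * a + 1) ≤ 2 * p ^ (q + 1) := by
    calc (p - 1).choose q * (2 * a + 1) ≤ (p - 1) ^ q * (2 * p) := by
          apply Nat.mul_le_mul (Nat.choose_le_pow _ _) (by omega)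
      _ ≤ p ^ q * (2 * p) := by
          apply Nat.mul_le_mul_right
          exact Nat.pow_le_pow_left (by omega) q
      _ = 2 * p ^ (q + 1) := by ring
  -- hence `2^{p+q} K C(p − 1, q) ≤ C(n − q, a)`
  have hkey : 2 ^ (p + q) * K * (p - 1).choose q ≤ (n - q).choose a := by
    have h1 : 2 ^ (p + q) * K * (p - 1).choose q * (2 * a + 1) ≤ (n - q).choose a * (2 * a + 1) := by
      calc 2 ^ (p + q) * K * (p - 1).choose q * (2 * a + 1)
          = 2 ^ (p + q) * K * ((p - 1).choose q * (2 * a + 1)) := by ring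
        _ ≤ 2 ^ (p + q) * K * (2 * p ^ (q + 1)) := Nat.mul_le_mul_left _ hsmall
        _ ≤ 4 ^ a := hT
        _ ≤ (2 * a + 1) * (n - q).choose a := hcb
        _ = (n - q).choose a * (2 * a + 1) := by ring
    exact Nat.le_of_mul_le_mul_right h1 (by omega)
  -- the identity `C(n, p−1) · C(p−1, q) = C(n, q) · C(n − q, a)`
  have hid : n.choose (p - 1) * (p - 1).choose q = n.choose q * (n - q).choose a := by
    rw [ha, Nat.choose_mul (by omega)]
  have hpos : 0 < (p - 1).choose q := Nat.choose_pos (by omega)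
  have h2 : 2 ^ (p + q) * K * n.choose q * (p - 1).choose q ≤ n.choose (p - 1) * (p - 1).choose q := by
    calc 2 ^ (p + q) * K * n.choose q * (p - 1).choose q
        = n.choose q * (2 ^ (p + q) * K * (p - 1).choose q) := by ring
      _ ≤ n.choose q * (n - q).choose a := Nat.mul_le_mul_left _ hkey
      _ = n.choose (p - 1) * (p - 1).choose q := hid.symm
  exact Nat.le_of_mul_le_mul_right h2 hpos

/-- **Polynomials are eventually below `2^n`**: for all `c k` there is `N` with `c · n^k ≤ 2^n` for every `n ≥ N`. -/
theorem exists_forall_mul_pow_le_two_pow (c k : ℕ) : ∃ N : ℕ, ∀ n, N ≤ n → c * n ^ k ≤ 2 ^ n := by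
  have hlim := tendsto_pow_const_div_const_pow_of_one_lt k (by norm_num : (1 : ℝ) < 2)
  have hpos : (0 : ℝ) < 1 / ((c : ℝ) + 1) := by positivity
  have hev : ∀ᶠ n : ℕ in Filter.atTop, ((n : ℝ) ^ k / (2 : ℝ) ^ n) < 1 / ((c : ℝ) + 1) :=
    hlim.eventually (gt_mem_nhds hpos)
  obtain ⟨N, hN⟩ := Filter.eventually_atTop.1 hev
  refine ⟨N, fun n hn => ?_⟩
  have h := hN n hn
  have h2 : (0 : ℝ) < 2 ^ n := by positivity
  rw [div_lt_div_iff₀ h2 (by positivity)] at h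
  have h' : (c : ℝ) * (n : ℝ) ^ k ≤ 2 ^ n := by nlinarith [pow_nonneg (Nat.cast_nonneg n : (0:ℝ) ≤ n) k]
  exact_mod_cast h'

end PercRepro
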